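import Summits.CriticalPhenomena.SAWScalingLimit.Theorems.SAWCompassLatticeSurfaceUniversalitySiteDictionary
import Summits.CriticalPhenomena.SAWScalingLimit.Theorems.SAWCompassLatticeSurfaceUniversalitySiteApprox
import Summits.CriticalPhenomena.SAWScalingLimit.Theorems.SAWCompassLatticeSurfaceUniversalityFaceSide
import Summits.CriticalPhenomena.SAWScalingLimit.Theorems.SAWCompassLatticeSurfaceUniversalityTightToll

/-!
# Glue of skeleton v6 of the line `registered` for the crux `SurfaceUniversality`
# (stmt-CriticalPhenomena-6964): the crux, and its sibling `YBtoUniform` (stmt-16966), from THREE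
# named research statements

Lead c2 (`--supports stmt-CriticalPhenomena-6964`). With the plumbing of v6 landed — the site dictionary
(`stub_siteDictionary`, p157234), the two admissibility facts (`stub_siteApprox`, `stub_faceSide`) and the
objects of `…SurfaceUniversalityApproxDefs` (p155098) — the `ℤ²`-side statement of the line,
`LipPlusPointIsZ2` (critical `δℤ²` SAW law vs critical plus-lattice law, bounded-Lipschitz merging), follows
from the ONE-MODEL statement `LipApproxIndependence` (independence of the lattice approximation), and the crux
follows from the three research-level statements BY NAME:

* `lipPlusPointIsZ2_of_lipApproxIndependence : LipApproxIndependence → LipPlusPointIsZ2`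
  (`∫dP^{ℤ²} − ∫dPlus = (∫dP^{ℤ²} − ∫dSite) + (∫dSite − ∫dFace)`, `Face = Plus` eventually, first bracket
  `≤ L·δ` eventually by the site dictionary, second `→ 0` by approximation independence applied to
  `(siteRule, siteCentre ∘ a, siteCentre ∘ b)` and `(faceRule, inl ∘ a', inl ∘ b')`);
* `surfaceUniversality_of_research :
    SAWParafermion.EventualTight → LipApproxIndependence → LipUnifToYB → SAWCompassLattice.SurfaceUniversality`
  (then as skeleton v5: `lipPlusToYB_of_unif lipPlusIsUnif`, `lipYBtoUniform_of_lipPlus`,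
  `surfaceUniversality_of_tight_of_lipMerge`);
* `ybToUniform_of_research : … → SAWTrackTransport.YBtoUniform` likewise (`ybToUniform_of_tight_of_lipMerge`).

So a route-level SPLIT of stmt-6964 (and of stmt-16966) into the children stmt-1881, `LipApproxIndependence`,
`LipUnifToYB` is glued by importable theorems. No new definition, no new hypothesis.
-/

noncomputable section

namespace Summit.CriticalPhenomena.SAWScalingLimit.Theorems.SurfaceUniversality.GlueV6

open MeasureTheory Filter Topology Set
open scoped NNReal ENNReal BoundedContinuousFunction
open Literature.Probability.RandomPlanarGeometry
open Literature.Probability.RandomPlanarGeometry.SAW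
open Literature.Probability.RandomPlanarGeometry.SAW.YangBaxter
open Literature.Probability.LatticeModels (Site meshDomain discreteDomainGraph discreteDomainGraph_adj_iff
  meshPoint)
open Summit.CriticalPhenomena.SAWScalingLimit.Theses

/-- **The `ℤ²`-side statement of the line from approximation independence** (v6 composition, landed):
`LipApproxIndependence → LipPlusPointIsZ2`. Approximation independence is applied to the site rule with the
centres of `a δ, b δ` and to the face rule with the ports `a' δ, b' δ` (both admissible: `stub_siteApprox`,
`stub_faceSide`); the site dictionary (`stub_siteDictionary`) moves the first law back to `SAW.law` at
cost `≤ L·δ` (eventually `a δ ∈ Ω_δ`: the endpoints are eventually distinct — their mesh points tend to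
the distinct marked points — and joined, so `a δ` has an edge of `Ω_δ`), and the face path law IS
`plusLaw` eventually. [folklore] -/
theorem lipPlusPointIsZ2_of_lipApproxIndependence (hR : LipApproxIndependence) : LipPlusPointIsZ2 := by
  intro D a b a' b' hab hab' f L hf
  obtain ⟨hjS, huS, hvS⟩ := stub_siteApprox D a b hab
  obtain ⟨hrestr, hjF, huF, hvF⟩ := stub_faceSide D a' b' hab'
  have hR' := hR D siteRule faceRule (fun δ => siteCentre (a δ)) (fun δ => siteCentre (b δ))
    (fun δ => Sum.inl (a' δ)) (fun δ => Sum.inl (b' δ)) hjS huS hvS hjF huF hvF f L hf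
  -- eventually `a δ ≠ b δ`
  have hne : ∀ᶠ δ in 𝓝[>] (0 : ℝ), a δ ≠ b δ := by
    have hpt : D.pt 0 ≠ D.pt 1 := fun h => absurd (D.pt_injective h) (by decide)
    obtain ⟨U, V, hU, hV, h0, h1, hUV⟩ := t2_separation hpt
    filter_upwards [hab.tendsto_fst (hU.mem_nhds h0), hab.tendsto_snd (hV.mem_nhds h1)]
      with δ hδ0 hδ1 heq
    have h0' : meshPoint δ (a δ) ∈ U := hδ0
    have h1' : meshPoint δ (b δ) ∈ V := hδ1
    rw [heq] at h0'
    exact Set.disjoint_left.1 hUV h0' h1'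
  -- eventually `a δ ∈ Ω_δ`
  have hmemD : ∀ᶠ δ in 𝓝[>] (0 : ℝ), a δ ∈ meshDomain D.carrier δ := by
    filter_upwards [hab.reachable, hne] with δ hr hne'
    obtain ⟨p⟩ := hr
    have hlen : 0 < p.length :=
      Nat.pos_of_ne_zero fun h0 => hne' (SimpleGraph.Walk.eq_of_length_eq_zero h0)
    have hadj := p.adj_getVert_succ hlen
    rw [SimpleGraph.Walk.getVert_zero] at hadj
    exact (discreteDomainGraph_adj_iff.1 hadj).2.1
  have hdict : ∀ᶠ δ in 𝓝[>] (0 : ℝ), ‖(∫ γ, f γ.curve ∂(SAW.law D.carrier δ (a δ) (b δ))) -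
      ∫ x, f x ∂(plusPathLaw (probeSupport siteRule D.carrier δ) δ (siteCentre (a δ))
        (siteCentre (b δ)))‖ ≤ L * δ := by
    filter_upwards [hmemD, self_mem_nhdsWithin] with δ hmem hδ
    exact stub_siteDictionary D.carrier δ (a δ) (b δ) D.isBounded hδ hmem f L hf
  have hLδ : Tendsto (fun δ : ℝ => (L : ℝ) * δ) (𝓝[>] (0 : ℝ)) (𝓝 0) := by
    have h : Tendsto (fun δ : ℝ => (L : ℝ) * δ) (𝓝 (0 : ℝ)) (𝓝 ((L : ℝ) * 0)) :=
      tendsto_const_nhds.mul tendsto_id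
    rw [mul_zero] at h
    exact tendsto_nhdsWithin_of_tendsto_nhds h
  have h1 : Tendsto (fun δ : ℝ => (∫ γ, f γ.curve ∂(SAW.law D.carrier δ (a δ) (b δ))) -
      ∫ x, f x ∂(plusPathLaw (probeSupport siteRule D.carrier δ) δ (siteCentre (a δ))
        (siteCentre (b δ)))) (𝓝[>] (0 : ℝ)) (𝓝 0) :=
    squeeze_zero_norm' hdict hLδ
  have h12 := h1.add hR'
  rw [add_zero] at h12
  refine h12.congr' ?_
  filter_upwards [hrestr] with δ hδ
  rw [hδ]
  ring

/-- **The crux from the three research statements of the line, BY NAME**: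
`EventualTight (stmt-1881) → LipApproxIndependence → LipUnifToYB → SurfaceUniversality` (through the landed
`lipPlusIsUnif`, `lipPlusToYB_of_unif`, `lipYBtoUniform_of_lipPlus` and the one-sided Prokhorov upgrade
`surfaceUniversality_of_tight_of_lipMerge`). [folklore] -/
theorem surfaceUniversality_of_research (hT : SAWParafermion.EventualTight) (hR : LipApproxIndependence)
    (hK : LipUnifToYB) : SAWCompassLattice.SurfaceUniversality :=
  surfaceUniversality_of_tight_of_lipMerge hT
    (lipYBtoUniform_of_lipPlus (lipPlusPointIsZ2_of_lipApproxIndependence hR)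
      (lipPlusToYB_of_unif lipPlusIsUnif hK))

/-- **The sibling crux from the same three statements**:
`EventualTight → LipApproxIndependence → LipUnifToYB → SAWTrackTransport.YBtoUniform` (stmt-16966).
[folklore] -/
theorem ybToUniform_of_research (hT : SAWParafermion.EventualTight) (hR : LipApproxIndependence)
    (hK : LipUnifToYB) : SAWTrackTransport.YBtoUniform :=
  ybToUniform_of_tight_of_lipMerge hT
    (lipYBtoUniform_of_lipPlus (lipPlusPointIsZ2_of_lipApproxIndependence hR)
      (lipPlusToYB_of_unif lipPlusIsUnif hK))

/-! ### Registered glue stubs of stmt-CriticalPhenomena-6964 (one-line signatures, proved verbatim) -/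

/-- Registered glue stub `glue_lipPlusPointIsZ2_of_approx`. [folklore] -/
theorem glue_lipPlusPointIsZ2_of_approx : LipApproxIndependence → LipPlusPointIsZ2 :=
  lipPlusPointIsZ2_of_lipApproxIndependence

/-- Registered glue stub `glue_surfaceUniversality_of_research`. [folklore] -/
theorem glue_surfaceUniversality_of_research : SAWParafermion.EventualTight → LipApproxIndependence → LipUnifToYB → SAWCompassLattice.SurfaceUniversality :=
  surfaceUniversality_of_research

/-- Registered glue stub `glue_ybToUniform_of_research`. [folklore] -/
theorem glue_ybToUniform_of_research : SAWParafermion.EventualTight → LipApproxIndependence → LipUnifToYB → SAWTrackTransport.YBtoUniform :=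
  ybToUniform_of_research

end Summit.CriticalPhenomena.SAWScalingLimit.Theorems.SurfaceUniversality.GlueV6

end
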